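import Summits.CriticalPhenomena.PercolationContinuityZ3.Theorems.PercNearOneGluingNoHeavyLowerTailHullThreeCertificate
import HarnessLib

/-!
# `NoHeavyLowerTail` (stmt-CriticalPhenomena-4575) — hull-port line, THREE PORTS: per-world positivity of the certificate

Hull-port prover #4 (`prim-hp-4`, LP-duality technique), generation 2; `--supports stmt-CriticalPhenomena-4575`.  No definitions,
no sorries.  Companion of `…HullThreeCertificate` (bit records `IB`, `OB`, masks `M3`, the join `jrel`, the functionals
`FU, FSh, FA1, FA2, FA12, lhsF, Phi`, the inner-law constants and relations `E1 … E4`, residual coefficients `k01, k02`, and the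
kernel-checked coefficient identity `coef_identity`).

Here the real-valued functionals are rewritten through their integer coefficient vectors (`lhsF_eq_sum`, `E1_eq_sum`, …) and the
identity is summed against an inner law `x : IB → ℝ` and a lightness function `H : M3 → ℝ`:

* `HullThree.phi_eq_target`: `Phi = k01·(H{0} − H{0,1}) + k02·(H{0} − H{0,2})` in the discrete outer world and `Phi = 0` in every
  other outer world, once `E1 = E2 = E3 = E4 = 0` and `x` vanishes off the closed patterns;
* `HullThree.phi_nonneg` (**per-world positivity**): if moreover `k01, k02 ≥ 0` and `H` is antitone (`m ⊆ m' → H m' ≤ H m`),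
  then `0 ≤ Phi x θ Λ α1 α2 α12 c H` for EVERY outer record `c`.
This is the statement "TARGET − Σ mult·ROW lies in the dual of the antitone cone for every outer shape" of memo
`run/shared/lean/prim/prim-hp-4/HULLPORT-LP.md` §9/§11 — the per-outer-configuration inequality that the companion files integrate
against the outer configuration.
-/

namespace Summit.CriticalPhenomena.PercolationContinuityZ3.Theorems

namespace HullThree

open Finset
open scoped BigOperators

/-! ### Evaluation of coefficient vectors -/

section ev

variable (θ Λ α1 α2 α12 : ℝ)

/-- The zero coefficient vector evaluates to `0`. -/
theorem ev_zero : C5.zero.ev θ Λ α1 α2 α12 = 0 := by simp [C5.ev, C5.zero]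

/-- Evaluation is additive. -/
theorem ev_add (p q : C5) : (p.add q).ev θ Λ α1 α2 α12 = p.ev θ Λ α1 α2 α12 + q.ev θ Λ α1 α2 α12 := by
  simp only [C5.ev, C5.add, Int.cast_add]; ring

/-- Evaluation respects subtraction. -/
theorem ev_sub (p q : C5) : (p.sub q).ev θ Λ α1 α2 α12 = p.ev θ Λ α1 α2 α12 - q.ev θ Λ α1 α2 α12 := by
  simp only [C5.ev, C5.sub, Int.cast_sub]; ring

/-- Evaluation respects integer scaling. -/
theorem ev_smul (z : ℤ) (p : C5) : (p.smul z).ev θ Λ α1 α2 α12 = (z : ℝ) * p.ev θ Λ α1 α2 α12 := by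
  simp only [C5.ev, C5.smul, Int.cast_mul]; ring

/-- Evaluation commutes with `if`. -/
theorem ev_ite (P : Prop) [Decidable P] (p q : C5) :
    (if P then p else q).ev θ Λ α1 α2 α12 = if P then p.ev θ Λ α1 α2 α12 else q.ev θ Λ α1 α2 α12 := by
  split_ifs <;> rfl

end ev

/-! ### From `if`-terms to coefficient sums -/

/-- `(ι P : ℝ) = if P then 1 else 0`. -/
theorem cast_iota (P : Prop) [Decidable P] : ((ι P : ℤ) : ℝ) = if P then 1 else 0 := by
  unfold ι; split_ifs <;> simp

/-- `if P then H m else 0` as a sum over masks against the coefficient `[P ∧ m = I]`. -/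
theorem pick (P : Prop) [Decidable P] (m : M3) (H : M3 → ℝ) :
    (if P then H m else 0) = ∑ I : M3, H I * (ι (P ∧ m = I) : ℝ) := by
  by_cases hP : P
  · simp only [hP, if_true, true_and, cast_iota]
    rw [Finset.sum_eq_single m]
    · simp
    · intro I _ hI
      rw [if_neg (Ne.symm hI), mul_zero]
    · intro h; exact absurd (Finset.mem_univ m) h
  · simp [hP, ι]

/-- `if P then x else 0 = x · [P]`. -/
theorem ite_eq_mul_iota (P : Prop) [Decidable P] (x : ℝ) : (if P then x else 0) = x * (ι P : ℝ) := by
  rw [cast_iota]; split_ifs <;> simp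

/-- `lhsF` in coefficient form. -/
theorem lhsF_eq_sum (θ Λ α1 α2 α12 : ℝ) (b : IB) (c : OB) (H : M3 → ℝ) :
    lhsF θ Λ α1 α2 α12 b c H = ∑ I : M3, H I * (coefL b c I).ev θ Λ α1 α2 α12 := by
  simp only [lhsF, FU, FSh, FA1, FA2, FA12, pick, coefL, C5.ev, cU, cSh, cA1, cA2, cA12, Int.cast_sub, Int.cast_add,
    Int.cast_neg, ← Finset.sum_sub_distrib, ← Finset.sum_add_distrib, Finset.mul_sum]
  refine Finset.sum_congr rfl fun I _ => ?_
  ring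

/-- `cst P x` in coefficient form. -/
theorem cst_eq_sum (P : IB → Bool) (x : IB → ℝ) : cst P x = ∑ b, x b * (ι (P b = true) : ℝ) := by
  unfold cst
  exact Finset.sum_congr rfl fun b _ => ite_eq_mul_iota _ _

/-- `E1` in coefficient form. -/
theorem E1_eq_sum (x : IB → ℝ) (θ Λ α1 α2 α12 : ℝ) :
    E1 x θ Λ α1 α2 α12 = ∑ b, x b * (cE1 b).ev θ Λ α1 α2 α12 := by
  simp only [E1, cst_eq_sum, cE1, C5.ev, Int.cast_add, Int.cast_mul, Int.cast_neg, Int.cast_ofNat, Finset.mul_sum,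
    ← Finset.sum_add_distrib, ← Finset.sum_sub_distrib]
  refine Finset.sum_congr rfl fun b _ => ?_
  ring

/-- `E2` in coefficient form. -/
theorem E2_eq_sum (x : IB → ℝ) (θ Λ α1 α2 α12 : ℝ) :
    E2 x θ Λ α1 = ∑ b, x b * (cE2 b).ev θ Λ α1 α2 α12 := by
  simp only [E2, cst_eq_sum, cE2, C5.ev, Int.cast_neg, Int.cast_zero, Finset.mul_sum, ← Finset.sum_sub_distrib]
  refine Finset.sum_congr rfl fun b _ => ?_
  ring

/-- `E3` in coefficient form. -/
theorem E3_eq_sum (x : IB → ℝ) (θ Λ α1 α2 α12 : ℝ) :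
    E3 x θ Λ α2 = ∑ b, x b * (cE3 b).ev θ Λ α1 α2 α12 := by
  simp only [E3, cst_eq_sum, cE3, C5.ev, Int.cast_neg, Int.cast_zero, Finset.mul_sum, ← Finset.sum_sub_distrib]
  refine Finset.sum_congr rfl fun b _ => ?_
  ring

/-- `E4` in coefficient form. -/
theorem E4_eq_sum (x : IB → ℝ) (θ Λ α1 α2 α12 : ℝ) :
    E4 x θ Λ α1 α2 α12 = ∑ b, x b * (cE4 b).ev θ Λ α1 α2 α12 := by
  simp only [E4, cst_eq_sum, cE4, C5.ev, Int.cast_neg, Int.cast_mul, Int.cast_ofNat, Finset.mul_sum,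
    ← Finset.sum_sub_distrib]
  refine Finset.sum_congr rfl fun b _ => ?_
  ring

/-- `k01` in coefficient form. -/
theorem k01_eq_sum (x : IB → ℝ) (θ Λ α1 α2 α12 : ℝ) :
    k01 x θ Λ α2 = ∑ b, x b * (cK01 b).ev θ Λ α1 α2 α12 := by
  simp only [k01, cst_eq_sum, cK01, C5.ev, Int.cast_neg, Int.cast_zero, Finset.mul_sum, ← Finset.sum_sub_distrib]
  refine Finset.sum_congr rfl fun b _ => ?_
  ring

/-- `k02` in coefficient form. -/
theorem k02_eq_sum (x : IB → ℝ) (θ Λ α1 α2 α12 : ℝ) :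
    k02 x θ Λ α1 = ∑ b, x b * (cK02 b).ev θ Λ α1 α2 α12 := by
  simp only [k02, cst_eq_sum, cK02, C5.ev, Int.cast_neg, Int.cast_zero, Finset.mul_sum, ← Finset.sum_sub_distrib]
  refine Finset.sum_congr rfl fun b _ => ?_
  ring

/-- The target part in closed form. -/
theorem target_eq (x : IB → ℝ) (θ Λ α1 α2 α12 : ℝ) (c : OB) (H : M3 → ℝ) :
    ∑ b, x b * ∑ I : M3, H I * (coefT c I b).ev θ Λ α1 α2 α12 =
      if c = OB.disc then k01 x θ Λ α2 * (H M0 - H M01) + k02 x θ Λ α1 * (H M0 - H M02) else 0 := by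
  by_cases hc : c = OB.disc
  · rw [if_pos hc, k01_eq_sum x θ Λ α1 α2 α12, k02_eq_sum x θ Λ α1 α2 α12, Finset.sum_mul, Finset.sum_mul,
      ← Finset.sum_add_distrib]
    refine Finset.sum_congr rfl fun b _ => ?_
    have hI : ∀ I : M3, H I * (coefT c I b).ev θ Λ α1 α2 α12 =
        (if M0 = I then H I * ((cK01 b).ev θ Λ α1 α2 α12 + (cK02 b).ev θ Λ α1 α2 α12) else 0) -
        (if M01 = I then H I * (cK01 b).ev θ Λ α1 α2 α12 else 0) -
        (if M02 = I then H I * (cK02 b).ev θ Λ α1 α2 α12 else 0) := by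
      intro I
      simp only [coefT, hc, if_true, ev_sub, ev_ite, ev_add, ev_zero, eq_comm (a := I)]
      split_ifs <;> ring
    simp only [hI, Finset.sum_sub_distrib, Finset.sum_ite_eq, Finset.mem_univ, if_true]
    ring
  · rw [if_neg hc]
    refine Finset.sum_eq_zero fun b _ => ?_
    rw [Finset.sum_eq_zero fun I _ => ?_, mul_zero]
    simp [coefT, hc, ev_zero]

/-- A cross term `Σ_b x_b Σ_I H_I (m_I · e_b)` factorises. -/
theorem cross_sum (x : IB → ℝ) (H : M3 → ℝ) (m : M3 → ℝ) (e : IB → ℝ) :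
    ∑ b, x b * ∑ I : M3, H I * (m I * e b) = (∑ I : M3, H I * m I) * ∑ b, x b * e b := by
  have h : ∀ b : IB, x b * ∑ I : M3, H I * (m I * e b) = ∑ I : M3, H I * m I * (x b * e b) := by
    intro b
    rw [Finset.mul_sum]
    exact Finset.sum_congr rfl fun I _ => by ring
  simp only [h]
  rw [Finset.sum_mul_sum, Finset.sum_comm]

/-- **The certificate, world by world.**  `Phi` equals the residual `k01·(H{0} − H{0,1}) + k02·(H{0} − H{0,2})` in the discrete
outer world and vanishes in every other outer world, once `E1 = E2 = E3 = E4 = 0` and `x` vanishes off the closed patterns. -/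
theorem phi_eq_target (x : IB → ℝ) (θ Λ α1 α2 α12 : ℝ) (hx : ∀ b : IB, b.closed = false → x b = 0)
    (hE1 : E1 x θ Λ α1 α2 α12 = 0) (hE2 : E2 x θ Λ α1 = 0) (hE3 : E3 x θ Λ α2 = 0)
    (hE4 : E4 x θ Λ α1 α2 α12 = 0) (c : OB) (H : M3 → ℝ) :
    Phi x θ Λ α1 α2 α12 c H =
      if c = OB.disc then k01 x θ Λ α2 * (H M0 - H M01) + k02 x θ Λ α1 * (H M0 - H M02) else 0 := by
  -- Step 1: rewrite every pattern term through the coefficient identity.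
  have step1 : Phi x θ Λ α1 α2 α12 c H =
      ∑ b, x b * ∑ I : M3, H I * ((coefT c I b).ev θ Λ α1 α2 α12 +
        ((m1 c I : ℝ) * (cE1 b).ev θ Λ α1 α2 α12 + (m2 c I : ℝ) * (cE2 b).ev θ Λ α1 α2 α12 +
          (m3 c I : ℝ) * (cE3 b).ev θ Λ α1 α2 α12 + (m4 c I : ℝ) * (cE4 b).ev θ Λ α1 α2 α12)) := by
    unfold Phi
    refine Finset.sum_congr rfl fun b _ => ?_
    by_cases hb : b.closed = true
    · rw [lhsF_eq_sum]
      congr 1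
      refine Finset.sum_congr rfl fun I _ => ?_
      rw [coef_identity b hb c I]
      simp only [ev_add, ev_smul]
      ring
    · rw [hx b (by simpa using hb), zero_mul, zero_mul]
  -- Step 2: the four `E`-sums vanish.
  have h1 : ∑ b, x b * (cE1 b).ev θ Λ α1 α2 α12 = 0 := (E1_eq_sum x θ Λ α1 α2 α12).symm.trans hE1
  have h2 : ∑ b, x b * (cE2 b).ev θ Λ α1 α2 α12 = 0 := (E2_eq_sum x θ Λ α1 α2 α12).symm.trans hE2
  have h3 : ∑ b, x b * (cE3 b).ev θ Λ α1 α2 α12 = 0 := (E3_eq_sum x θ Λ α1 α2 α12).symm.trans hE3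
  have h4 : ∑ b, x b * (cE4 b).ev θ Λ α1 α2 α12 = 0 := (E4_eq_sum x θ Λ α1 α2 α12).symm.trans hE4
  -- Step 3: split and factorise.
  have split : ∑ b, x b * ∑ I : M3, H I * ((coefT c I b).ev θ Λ α1 α2 α12 +
        ((m1 c I : ℝ) * (cE1 b).ev θ Λ α1 α2 α12 + (m2 c I : ℝ) * (cE2 b).ev θ Λ α1 α2 α12 +
          (m3 c I : ℝ) * (cE3 b).ev θ Λ α1 α2 α12 + (m4 c I : ℝ) * (cE4 b).ev θ Λ α1 α2 α12)) =
      (∑ b, x b * ∑ I : M3, H I * (coefT c I b).ev θ Λ α1 α2 α12) +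
      ((∑ b, x b * ∑ I : M3, H I * ((m1 c I : ℝ) * (cE1 b).ev θ Λ α1 α2 α12)) +
       (∑ b, x b * ∑ I : M3, H I * ((m2 c I : ℝ) * (cE2 b).ev θ Λ α1 α2 α12)) +
       (∑ b, x b * ∑ I : M3, H I * ((m3 c I : ℝ) * (cE3 b).ev θ Λ α1 α2 α12)) +
       (∑ b, x b * ∑ I : M3, H I * ((m4 c I : ℝ) * (cE4 b).ev θ Λ α1 α2 α12))) := by
    simp only [mul_add, Finset.sum_add_distrib]
  rw [step1, split, cross_sum, cross_sum, cross_sum, cross_sum, h1, h2, h3, h4, target_eq]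
  ring

/-- **Per-world positivity.**  Under the relations `E1 = … = E4 = 0`, residual signs `k01, k02 ≥ 0` and antitonicity of `H`,
`0 ≤ Phi x θ Λ α1 α2 α12 c H` for every outer record `c`. -/
theorem phi_nonneg (x : IB → ℝ) (θ Λ α1 α2 α12 : ℝ) (hx : ∀ b : IB, b.closed = false → x b = 0)
    (hE1 : E1 x θ Λ α1 α2 α12 = 0) (hE2 : E2 x θ Λ α1 = 0) (hE3 : E3 x θ Λ α2 = 0)
    (hE4 : E4 x θ Λ α1 α2 α12 = 0) (hk01 : 0 ≤ k01 x θ Λ α2) (hk02 : 0 ≤ k02 x θ Λ α1)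
    (c : OB) (H : M3 → ℝ) (hH : ∀ m m' : M3, m.sub m' = true → H m' ≤ H m) :
    0 ≤ Phi x θ Λ α1 α2 α12 c H := by
  rw [phi_eq_target x θ Λ α1 α2 α12 hx hE1 hE2 hE3 hE4 c H]
  by_cases hc : c = OB.disc
  · rw [if_pos hc]
    have h1 : H M01 ≤ H M0 := hH M0 M01 (by decide)
    have h2 : H M02 ≤ H M0 := hH M0 M02 (by decide)
    exact add_nonneg (mul_nonneg hk01 (sub_nonneg.2 h1)) (mul_nonneg hk02 (sub_nonneg.2 h2))
  · rw [if_neg hc]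

end HullThree

end Summit.CriticalPhenomena.PercolationContinuityZ3.Theorems
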